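import Literature.IUT.HodgeTheaters.PiAvatarBadPairAtStandIn
import Literature.IUT.HodgeTheaters.PiAvatarLocalArrowLawL2Sign
import HarnessLib

/-!
# The [IUTchI] §6 base kit with the (L2) sign law DISCHARGED (abc-iut-L5-d5): `baseKitOfBadPairs` (genuine shape, binders
# {`CG`, `hS`, `M`, `hA`, `hI`, `B`, `ΛBad`}) and `baseKitStandIn` (the `X̲→`-stand-in at bad places, binders {`CG`, `hS`, `M`, `hA`, `hI`});
# and WHY stand-in (U) cannot carry a local arrow law ([IUTchI] Def 6.1; defs + lemmas — post-freeze additive D13, not a cone member)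

S. Mochizuki, *Inter-universal Teichmüller theory I*, kurims manuscript (May 2020), Def 6.1 (ii)–(vii) pp. 156–159 (the `𝒟`-data and the
`±`-structure; (iii) p. 157: `Aut_±` and the sign), Def 3.1 (e)(f) pp. 62–63, Ex 6.3 (i)(ii) p. 161, Prop 6.6 (ii)(iii) p. 165, Prop 6.8 (i) p. 167
([IUTchI] Def 6.1 (iii) p.157) [claim: Mochizuki2012, status: disputed] (D-0012 claim key, series status DISPUTED — constructions and kernel
lemmas over abc-iut-L5-t2's REAL `InitialThetaData`, packaging abc-iut-L5-t4's `baseKitOfTorsionMonodromy` (p446463) /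
`baseKitArrowStandIn` (p447892) with abc-iut-L5-d5's (L2) theorem `localArrowLaw_L2_sign_local` (PiAvatarLocalArrowLawL2Sign); nothing of
the series is asserted, no side is taken on [IUTchIII] Cor. 3.12).

## What is built / proved
* **`not_sign_PiXund_inf`**, **`not_localArrowLaw_PiXund_inf`**, **`not_localArrowLaw_badPairAtUnd`** (under `Π_{X̲_K} ⊴ Π_{X_K}`, e.g. from a
  torsion monodromy `M`): the full decomposition group `Π_{X̲_v̲} = Π_{X̲_K} ∩ augGF⁻¹ G_v̲` carries NO local arrow law — the generator of
  `Gal(X̲_K/X_K)`, made geometric, normalises it and `Π_{X̲_K}` but moves `ε⁰ ↦ ε′` (`0 ↦ 1` in the chart), which no sign `ε ∈ {±1}` does.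
  So stand-in (U) of PiAvatarBadPairAtStandIn witnesses the TYPE `BadPairAt v` only, never a kit input (its CAVEAT, now a theorem).
* **`baseKitOfBadPairs CG hS M hA hI B ΛBad`** := `baseKitOfTorsionMonodromy` with `hsign := fun v _ => localArrowLaw_L2_sign_local hA (G_v̲)`:
  the GENUINE-SHAPE kit; binders `CG` (cusp/Galois DATA), `hS` (G-L5t4g3-3), `M : TorsionMonodromy` (NV #45), `hA` (t1 §1 claims), `hI`
  ((rel)-type law), and the bad-place DATA `B` with its laws `ΛBad` (the tempered `Π^tp_{X̳_v̲}` side — L3/[EtTh], after-merge). (α), (β).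
* **`baseKitStandIn CG hS M hA hI`** := `baseKitArrowStandIn` with the same `hsign`: «[`X̲→`-profinite stand-in at `v̲ ∈ V̲^bad`]» — every
  binder of Def 6.1's kit DISCHARGED except the five standing ones; `placeKitStandIn` (+ `_kit`); (α) `phiEllSync_baseKitStandIn`,
  (β) `negCompatModel_baseKitStandIn`, Prop 6.6 (ii)(iii) / 6.8 (i) / Ex 6.3 (ii) at it. HONESTY TAG: print's `𝒟_v̲` at a bad place is
  `ℬ^temp(X̳_v̲)⁰`, NOT this kit's `ℬ(Π_{X̲→_v̲})⁰`; the tag travels with every token citing `baseKitStandIn`.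
No instance (the `Normal` instance is a hypothesis or supplied by `haveI` from `M`), no notation; typed ≠ inhabited ≠ proved; binders ≠ facts.
-/

noncomputable section

namespace Literature.IUT.HodgeTheaters

open CategoryTheory

universe u v w

section BaseKitStandIn

variable {F : Type u} {K : Type v} {Fbar : Type w} [Field F] [NumberField F] [Field K] [NumberField K]
  [Algebra F K] [Field Fbar] [Algebra F Fbar] [Algebra K Fbar]
  {E : WeierstrassCurve F} [E.IsElliptic] {l : ℕ} {Pb : BadPlacePredicates K}
  (D : InitialThetaData F K Fbar E l Pb) (CG : D.geom.pe.CuspGalois) (hS : D.CuspClassesNormaliserStable) [Fact l.Prime]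

namespace InitialThetaData

/-! ### Stand-in (U) carries no local arrow law -/

/-- **The (L2) sign law FAILS on the full decomposition group `Π_{X̲_v̲} = Π_{X̲_K} ∩ augGF⁻¹ G_v̲`** (for any `Gv ≤ G_F`, given
`Π_{X̲_K} ⊴ Π_{X_K}`): the generator `gen ∈ Π_X` of `Gal(X̲/X)` (t1's `CuspGalois`), pushed into `Π_{C_F}` and multiplied by an element of
`Π_{X̲_K}` with the same Galois image, is GEOMETRIC (so lies over `Gv`), normalises `Π_{X̲_K}` and `Π_{X̲_K} ∩ augGF⁻¹ G_v̲`, and acts on the cusps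
of `X̲_K` as `gen` does: `ε⁰ ↦ ε′`, i.e. `0 ↦ 1` in the chart `gChart₀` — not of the form `z ↦ ε·z`.
([IUTchI] Def 6.1 (iii) p.157) [claim: Mochizuki2012, status: disputed] -/
theorem not_sign_PiXund_inf [(D.PiXund.subgroupOf D.PiXK).Normal] (Gv : Subgroup (Fbar ≃ₐ[F] Fbar)) :
    ¬ ∀ n : D.PiC, n ∈ Subgroup.normalizer ((D.PiXund ⊓ Gv.comap D.augGF : Subgroup D.PiC) : Set D.PiC) →
      ∀ hn : n ∈ Subgroup.normalizer ((D.PiXund : Subgroup D.PiC) : Set D.PiC),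
        ∃ ε : ℤˣ, ∀ x, D.gChart₀Model CG (D.actF CG hS ⟨n, hn⟩ x) = ε • D.gChart₀Model CG x := by
  intro h
  -- `embK gen ∈ Π_{X_K} ≤ Π_{C_K}`, so its Galois image lies in `G_K = augGF(Π_{X̲_K})`
  have hgK : D.geom.embK CG.gen ∈ D.PiXK := by
    rw [D.PiXK_eq_map]
    exact Subgroup.mem_map_of_mem _ CG.gen_mem
  have hgC : D.geom.embK CG.gen ∈ D.PiCK := by
    rw [InitialThetaData.PiCK]
    exact ⟨_, rfl⟩
  have hgG : D.augGF (D.geom.embK CG.gen) ∈ galoisSubgroupOf F K Fbar := by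
    rw [D.PiCK_eq_comap_augGF] at hgC
    exact hgC
  obtain ⟨u, huU, hu⟩ := D.galoisSubgroupOf_le_map_PiXund hgG
  -- normalisers
  have hNle : D.PiXK ≤ Subgroup.normalizer ((D.PiXund : Subgroup D.PiC) : Set D.PiC) :=
    (Subgroup.normal_subgroupOf_iff_le_normalizer D.PiXund_le_PiXK).mp inferInstance
  have hgN : D.geom.embK CG.gen ∈ Subgroup.normalizer ((D.PiXund : Subgroup D.PiC) : Set D.PiC) := hNle hgK
  have huN : u ∈ Subgroup.normalizer ((D.PiXund : Subgroup D.PiC) : Set D.PiC) := hNle (D.PiXund_le_PiXK huU)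
  have hnN : D.geom.embK CG.gen * u⁻¹ ∈ Subgroup.normalizer ((D.PiXund : Subgroup D.PiC) : Set D.PiC) :=
    Subgroup.mul_mem _ hgN (Subgroup.inv_mem _ huN)
  -- the corrected element is geometric
  have hn1 : D.augGF (D.geom.embK CG.gen * u⁻¹) = 1 := by
    rw [map_mul, map_inv, hu, mul_inv_cancel]
  have hnH : D.geom.embK CG.gen * u⁻¹ ∈
      Subgroup.normalizer ((D.PiXund ⊓ Gv.comap D.augGF : Subgroup D.PiC) : Set D.PiC) := by
    refine Subgroup.mem_normalizer_iff.mpr fun y => ?_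
    have hy := Subgroup.mem_normalizer_iff.mp hnN y
    simp only [Subgroup.mem_inf, Subgroup.mem_comap, map_mul, map_inv, hn1, one_mul, inv_one, mul_one] at hy ⊢
    exact and_congr_left' hy
  -- it acts on the cusps as `gen`
  have hact : D.actF CG hS ⟨D.geom.embK CG.gen * u⁻¹, hnN⟩ = CG.act CG.gen := by
    have h1 : (⟨D.geom.embK CG.gen * u⁻¹, hnN⟩ : ↥(Subgroup.normalizer ((D.PiXund : Subgroup D.PiC) : Set D.PiC))) =
        ⟨D.geom.embK CG.gen, hgN⟩ * ⟨u, huN⟩⁻¹ := rfl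
    rw [h1, map_mul, map_inv, D.actF_eq_one_of_mem_PiXund CG hS ⟨u, huN⟩ huU, inv_one, mul_one, D.actF_embK CG hS]
  obtain ⟨ε, hε⟩ := h _ hnH hnN
  have h0 := hε D.geom.pe.ε0
  rw [hact, CG.act_gen_ε0, D.gChart₀Model_ε1 CG, D.gChart₀Model_ε0 CG, smul_zero] at h0
  exact one_ne_zero h0

/-- **`Π_{X̲_v̲}` carries NO local arrow law** (its (L2) field fails, `not_sign_PiXund_inf`). ([IUTchI] Def 6.1 (iii) p.157) [claim: Mochizuki2012, status: disputed] -/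
theorem not_localArrowLaw_PiXund_inf [(D.PiXund.subgroupOf D.PiXK).Normal] (Gv : Subgroup (Fbar ≃ₐ[F] Fbar)) :
    ¬ D.LocalArrowLaw CG hS (D.PiXund ⊓ Gv.comap D.augGF) :=
  fun Λ => D.not_sign_PiXund_inf CG hS Gv Λ.sign

/-- **Stand-in (U) is TYPE-NV only**: its `H = Π_{X̲_v̲}` carries no local arrow law, so `badPairAtUnd` can never be the `B` of a kit.
([IUTchI] Def 6.1 (iii) p.157) [claim: Mochizuki2012, status: disputed] -/
theorem not_localArrowLaw_badPairAtUnd [(D.PiXund.subgroupOf D.PiXK).Normal] (v : D.IndexCopy) :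
    ¬ D.LocalArrowLaw CG hS (D.badPairAtUnd v).H :=
  D.not_localArrowLaw_PiXund_inf CG hS (D.decompAt v)

/-- The same with the normality supplied by a torsion monodromy `M` (abc-iut-L5-t8). ([IUTchI] Def 6.1 (iii) p.157) [claim: Mochizuki2012, status: disputed] -/
theorem not_localArrowLaw_badPairAtUnd_of_torsionMonodromy (M : D.TorsionMonodromy) (v : D.IndexCopy) :
    ¬ D.LocalArrowLaw CG hS (D.badPairAtUnd v).H := by
  haveI := M.normal_PiXund_subgroupOf_PiXK
  exact D.not_localArrowLaw_badPairAtUnd CG hS v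

/-! ### The genuine-shape kit with (L2) discharged: binders {`CG`, `hS`, `M`, `hA`, `hI`, `B`, `ΛBad`} -/

variable (M : D.TorsionMonodromy) (hA : D.geom.pe.ArrowCoveringClaims)
  (hI : ∀ k ∈ D.geom.pe.inertia D.geom.pe.ε1, M.tau (D.geom.embK k) = 0)

section Genuine

variable (B : ∀ v, v ∈ D.indexCopyBad → D.BadPairAt v) (ΛBad : ∀ v (h : v ∈ D.indexCopyBad), D.LocalArrowLaw CG hS (B v h).H)

/-- **THE GENUINE-SHAPE BASE KIT, (L2) discharged**: `baseKitOfTorsionMonodromy` (p446463) with the good-place sign law the THEOREM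
`localArrowLaw_L2_sign_local hA (G_v̲)` (abc-iut-L5-d5). Binders: `CG`, `hS`, `M`, `hA`, `hI`, and the bad-place DATA `B` with its laws `ΛBad`.
([IUTchI] Def 6.1 (ii)-(vii) pp.156-159) [claim: Mochizuki2012, status: disputed] -/
def baseKitOfBadPairs : PMBaseKit.{w} l :=
  D.baseKitOfTorsionMonodromy CG hS M hA hI B (fun v _ => D.localArrowLaw_L2_sign_local CG hS hA (D.decompAt v)) ΛBad

/-- **(α)** at `baseKitOfBadPairs`. ([IUTchI] Ex 6.3 (i) p.161) [claim: Mochizuki2012, status: disputed] -/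
theorem phiEllSync_baseKitOfBadPairs : PMBaseKit.Ex63.PhiEllSync (D.baseKitOfBadPairs CG hS M hA hI B ΛBad) :=
  D.phiEllSync_baseKitOfTorsionMonodromy CG hS M hA hI _ _ _

/-- **(β)** at `baseKitOfBadPairs`. ([IUTchI] Ex 6.3 (ii) p.161) [claim: Mochizuki2012, status: disputed] -/
theorem negCompatModel_baseKitOfBadPairs : PMBaseKit.Ex63.NegCompatModel (D.baseKitOfBadPairs CG hS M hA hI B ΛBad) :=
  D.negCompatModel_baseKitOfTorsionMonodromy CG hS M hA hI _ _ _

/-- **[IUTchI] Prop 6.6 (ii)** at `baseKitOfBadPairs`. ([IUTchI] Prop 6.6 (ii) p.165) [claim: Mochizuki2012, status: disputed] -/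
theorem isoTorsor_thetaEllBridge_baseKitOfBadPairs (B₁ B₂ : (D.baseKitOfBadPairs CG hS M hA hI B ΛBad).DThetaEllBridge) :
    PMBaseKit.DThetaEllBridge.IsoTorsor B₁ B₂ :=
  PMBaseKit.DThetaEllBridge.isoTorsor_of_negCompatModel (D.negCompatModel_baseKitOfBadPairs CG hS M hA hI B ΛBad) B₁ B₂

/-- **[IUTchI] Prop 6.6 (iii)** at `baseKitOfBadPairs`. ([IUTchI] Prop 6.6 (iii) p.165) [claim: Mochizuki2012, status: disputed] -/
theorem isoTorsor_thetaPMEllHT_baseKitOfBadPairs (H₁ H₂ : (D.baseKitOfBadPairs CG hS M hA hI B ΛBad).DThetaPMEllHT) :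
    PMBaseKit.DThetaPMEllHT.IsoTorsor H₁ H₂ :=
  PMBaseKit.DThetaPMEllHT.isoTorsor_of_negCompatModel (D.negCompatModel_baseKitOfBadPairs CG hS M hA hI B ΛBad) H₁ H₂

/-- **[IUTchI] Prop 6.8 (i)** at `baseKitOfBadPairs`. ([IUTchI] Prop 6.8 (i) p.167) [claim: Mochizuki2012, status: disputed] -/
theorem ellBridgeSymmetry_baseKitOfBadPairs (H : (D.baseKitOfBadPairs CG hS M hA hI B ΛBad).DThetaPMEllHT) :
    PMBaseKit.DThetaPMEllHT.EllBridgeSymmetry H :=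
  PMBaseKit.DThetaPMEllHT.ellBridgeSymmetry_of_negCompatModel (D.negCompatModel_baseKitOfBadPairs CG hS M hA hI B ΛBad) H

/-- **[IUTchI] Ex 6.3 (ii)** (negative `γ`) at `baseKitOfBadPairs`. ([IUTchI] Ex 6.3 (ii) p.161) [claim: Mochizuki2012, status: disputed] -/
theorem equivariant_baseKitOfBadPairs {γ : FlPM l} (hγ : γ.IsNegative) :
    PMBaseKit.Ex63.Equivariant (D.baseKitOfBadPairs CG hS M hA hI B ΛBad) γ :=
  (D.negCompatModel_baseKitOfBadPairs CG hS M hA hI B ΛBad).equivariant hγ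

end Genuine

/-! ### The stand-in kit with (L2) discharged: binders {`CG`, `hS`, `M`, `hA`, `hI`} -/

/-- **THE STAND-IN BASE KIT, every kit binder discharged but the five standing ones**: `baseKitArrowStandIn` (p447892) with
`hsign := fun v => localArrowLaw_L2_sign_local hA (G_v̲)`. «[`X̲→`-profinite stand-in at `v̲ ∈ V̲^bad`]»: print's `𝒟_v̲` there is
`ℬ^temp(X̳_v̲)⁰`, NOT this kit's `ℬ(Π_{X̲→_v̲})⁰`. ([IUTchI] Def 6.1 (ii)-(vii) pp.156-159) [claim: Mochizuki2012, status: disputed] -/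
def baseKitStandIn : PMBaseKit.{w} l :=
  D.baseKitArrowStandIn hA CG hS M hI (fun v => D.localArrowLaw_L2_sign_local CG hS hA (D.decompAt v))

/-- The stand-in PLACE KIT over `V̲`. ([IUTchI] Def 3.1 (e) p.62) [claim: Mochizuki2012, status: disputed] -/
def placeKitStandIn : PlaceKit.{w} D :=
  D.placeKitArrowStandIn hA CG hS M hI (fun v => D.localArrowLaw_L2_sign_local CG hS hA (D.decompAt v))

/-- Its kit is `baseKitStandIn`. ([IUTchI] Def 6.1 (ii) p.156) [claim: Mochizuki2012, status: disputed] -/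
theorem placeKitStandIn_kit : (D.placeKitStandIn CG hS M hA hI).kit = D.baseKitStandIn CG hS M hA hI := rfl

/-- The local group of the stand-in kit at EVERY index is `Π_{X̲→_K} ∩ augGF⁻¹ G_v̲`. ([IUTchI] Def 3.1 (f) p.63) [claim: Mochizuki2012, status: disputed] -/
theorem baseKitStandIn_model_obj (v : D.IndexCopy) :
    ((D.baseKitStandIn CG hS M hA hI).model v).obj = OrbitCat.of (D.PiXarrow ⊓ (D.decompAt v).comap D.augGF) := by
  change (D.localDatumAt (fun v _ => D.badPairAtArrow hA v) CG hS hA _ v).locObj = _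
  rw [LocalDatum.locObj, D.localDatumAt_H, D.localGroupAt_badPairAtArrow]

/-- **(α)** at `baseKitStandIn`. ([IUTchI] Ex 6.3 (i) p.161) [claim: Mochizuki2012, status: disputed] -/
theorem phiEllSync_baseKitStandIn : PMBaseKit.Ex63.PhiEllSync (D.baseKitStandIn CG hS M hA hI) :=
  D.phiEllSync_baseKitArrowStandIn hA CG hS M hI _

/-- **(β)** at `baseKitStandIn`. ([IUTchI] Ex 6.3 (ii) p.161) [claim: Mochizuki2012, status: disputed] -/
theorem negCompatModel_baseKitStandIn : PMBaseKit.Ex63.NegCompatModel (D.baseKitStandIn CG hS M hA hI) :=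
  D.negCompatModel_baseKitArrowStandIn hA CG hS M hI _

/-- **[IUTchI] Prop 6.6 (ii)** at `baseKitStandIn`. ([IUTchI] Prop 6.6 (ii) p.165) [claim: Mochizuki2012, status: disputed] -/
theorem isoTorsor_thetaEllBridge_baseKitStandIn (B₁ B₂ : (D.baseKitStandIn CG hS M hA hI).DThetaEllBridge) :
    PMBaseKit.DThetaEllBridge.IsoTorsor B₁ B₂ :=
  PMBaseKit.DThetaEllBridge.isoTorsor_of_negCompatModel (D.negCompatModel_baseKitStandIn CG hS M hA hI) B₁ B₂

/-- **[IUTchI] Prop 6.6 (iii)** at `baseKitStandIn`. ([IUTchI] Prop 6.6 (iii) p.165) [claim: Mochizuki2012, status: disputed] -/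
theorem isoTorsor_thetaPMEllHT_baseKitStandIn (H₁ H₂ : (D.baseKitStandIn CG hS M hA hI).DThetaPMEllHT) :
    PMBaseKit.DThetaPMEllHT.IsoTorsor H₁ H₂ :=
  PMBaseKit.DThetaPMEllHT.isoTorsor_of_negCompatModel (D.negCompatModel_baseKitStandIn CG hS M hA hI) H₁ H₂

/-- **[IUTchI] Prop 6.8 (i)** at `baseKitStandIn`. ([IUTchI] Prop 6.8 (i) p.167) [claim: Mochizuki2012, status: disputed] -/
theorem ellBridgeSymmetry_baseKitStandIn (H : (D.baseKitStandIn CG hS M hA hI).DThetaPMEllHT) :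
    PMBaseKit.DThetaPMEllHT.EllBridgeSymmetry H :=
  PMBaseKit.DThetaPMEllHT.ellBridgeSymmetry_of_negCompatModel (D.negCompatModel_baseKitStandIn CG hS M hA hI) H

/-- **[IUTchI] Ex 6.3 (ii)** (negative `γ`) at `baseKitStandIn`. ([IUTchI] Ex 6.3 (ii) p.161) [claim: Mochizuki2012, status: disputed] -/
theorem equivariant_baseKitStandIn {γ : FlPM l} (hγ : γ.IsNegative) :
    PMBaseKit.Ex63.Equivariant (D.baseKitStandIn CG hS M hA hI) γ :=
  (D.negCompatModel_baseKitStandIn CG hS M hA hI).equivariant hγ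

end InitialThetaData

end BaseKitStandIn

end Literature.IUT.HodgeTheaters
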